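import Literature.AlgebraicGeometry.Hu2025.Statements.S05ThetaBlowups.R106aCharts
import Mathlib.Data.Prod.Lex
import Mathlib.Data.List.FinRange
import Mathlib.Algebra.BigOperators.Group.Finset.Basic

/-!
# Hu 2025 (arXiv:2507.21400v1), §5.2 (from Def. 5.7) – §5.4: Def. 5.7, (eq-B-ktau), Def. 5.8, Def. 5.9, Prop. 5.11,
# (conv:=1), Prop. 5.12, Def. 5.13, Def. 5.14, Def. 5.15, (fV-fV0), Prop. 5.16, Cor. 5.17, Cor. 5.18, Def. 5.19, Rem. 5.20
# — statements-first typing of lit/PARTITION-HU.md row 106 after the interface I-CH, cut into THREE files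
# `S05ThetaBlowups/R106bThetaFrame.lean` (this file: the §3–§4 frame, Def. 5.7/5.8, the relations on `𝔙_[0]`),
# `R106cThetaBlowups.lean` (Def. 5.9–5.15, Prop. 5.11/5.12, Def. 5.13) and `R106dThetaEquations.lean` (Def. 5.14, Prop. 5.16,
# Cor. 5.17/5.18, Def. 5.19, Rem. 5.20) — each ≤ 40 declarations (statement-lane limit); PARTITION's two file names b/c become three —
# FILED by res-type-023 (gen 9) as row-106 owner per the M-Hu re-pointing line 2026-08-27T08:00:07Z (director-resolution g4, M-Hu-min OPEN; REPOINT LIST OF RECORD res-dag-1 04:27Z); T9: every locator re-read on the chunks in this seat 2026-08-27T05:4xZ; pre-drafts g4–g9 under HOME/plan/tools/res-type-023/hu/ Each file imports the previous one (`R106aCharts` ← b ← c ← d).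

**STATUS OF THE SOURCE (D-0012 / D-0089): UNREFEREED PREPRINT UNDER ADJUDICATION** (see the header of `R106aCharts`).
Statements are `def … : Prop` CANDIDATES `[claim: Hu2025, status: under-review]` — «STATUS: candidate statement under
adjudication (D-0012/D-0089); not asserted»; definitions are real; nothing is proved or asserted; no decl takes a side.
AI typing, weaker than expert review. Locators = chunk + line of the TeX-chunk text of record (`lit read paper:arxiv-2507.21400`),
PDF page next to it.

## The FRAME (OURS packaging — how §5.2–§5.4 consume §§3–4; every field ↦ the row that owns it)
§5.3–§5.4 use, of §§3–4, only the following FINITE COMBINATORIAL DATA attached to the chart `𝔙_[0]` of `ℛ = 𝔙_{ϑ[0]}` (the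
charts of `ℛ̃_{ϑ[k]}` are taken «lying over a unique chart 𝔙_[0] of ℛ̃_{ϑ[0]} = ℛ», Prop. 5.11 C37L25–L29): the number `Υ` of
primary relations `F_1 < ⋯ < F_Υ` (§3.5 (list-sF) C20L44–L48); for each `F_k` its leading ϖ-index `u_k = u_{F_k} ∈ 𝕀^lt`
(C36L120 «𝕀^lt = {u_1 < ⋯ < u_Υ}», C35L107–L109 «compatible with that on 𝔉»), its leading ϱ-coordinate `(m,u_k)` (Def. 4.48) —
a VARIABLE of `𝔙_[0]` unless it is the coordinate `≡ 1` of the chart («(m,u_k) ∈ Λ^o», Prop. 5.16 C38L128; Def. 4.45 ‹chunk 4.44› (index-sR)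
C30L109–L111) —, its non-leading terms `s_1 < ⋯ < s_{𝔱_{F_k}}` (C36L3–L5, ordered by Def. 5.7) each with its ϖ-indices
`(u_s, v_s)` (§4.1 C21L16–L21), its ϱ-coordinate `x_{(u_s,v_s)}` (a variable of `𝔙_[0]`, or `≡ 1`), its sign `sgn(s)`
(L_F = Σ sgn(s) x_{(u_s,v_s)}, Prop. 4.56 display C32L162); the block map ϱ-index ↦ F (Def. 4.3 ‹chunk 4.2› multi-homogeneity);
and the set `𝓑^𝔯𝔟` of 𝔯𝔟-binomials restricted to `𝔙_[0]` (row 104/105; opaque here). This is the structure `ThetaFrame P Rs`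
(`P` = ϖ-variable indices `𝕀^⋆ = 𝕀_{3,n} ∖ {m}` = row 101 `S03Pluecker.PVar n`; `Rs` = the ϱ-variable indices of `𝔙_[0]`,
`Λ^⋆_𝔉` of Def. 4.45 / Prop. 5.11 C37L30). DICTIONARY for the owner (pre-drafts of record, PARTITION-HU §1b pointer block):
`ult` ↦ I-ORD's enumeration of `{u // IsLt u}` (res-type-009 `Def3_15`/`WpLT`); `lead`, `termR`, `termP₁/termP₂`, `sgn*` ↦ I-GOV's
`head`, `rel`, `imgExp`, `sgn` over I-R's term type `T` (res-type-079 v2 / res-type-024 `rhoVar`, `img`), de-homogenised at the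
chart index `Λ^o` (Def. 4.45 «choose and fix s_{F_i,o}» — an EXPLICIT parameter, PARTITION-HU §6 (d): it is the `none`
pattern of `lead`/`termR`); `blk` ↦ I-R's block of a ϱ-variable; `rb` ↦ row 104 `rbBinomial`/`Def4_32` restricted to the chart.
The variable index type of EVERY chart over `𝔙_[0]` is `P ⊕ Rs` (Prop. 5.11 (var-vtk) C37L49–L62: `Var_𝔙` is indexed by
`𝕀^⋆ ⊔ Λ^⋆` at every level, only the LABELS ε/δ/x change) — the «Carrier level» of `R106aCharts`.

## Standard charts of `ℛ̃_{ϑ[k]}` over `𝔙_[0]` (Def. 5.9, Prop. 5.11 proof, Def. 5.15)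
The ϑ-blow-ups are performed in the order `ϑ_[1], …, ϑ_[Υ]` (Def. 5.9 C36L126–L134). Seen from `𝔙_[0]`, the `k`-th step is:
NO CHANGE if `(m,u_k) ∈ Λ^o` (Prop. 5.11 proof C37L110–L116 «𝔙' does not intersect the proper transform of the blowup center …
𝔙 → 𝔙' is an isomorphism. In this case, we let Var_𝔙 = Var_𝔙'»), otherwise ONE `ChartStep` with centre `{x_{u_k}, x_{(m,u_k)}}`
(C39L131–L134 «the proper transform of the ϑ-center ϑ_[k] on the chart 𝔙' equals to (x_{𝔙',u_k}, x_{𝔙',(m,u_k)})») and a CHOICE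
of chart: ϖ-standard `(ξ_0 ≡ 1)`, exceptional variable `ε_{𝔙,u_k} := x_{𝔙',u_k}` (C37L128–L150), or ϱ-standard `(ξ_1 ≡ 1)`,
exceptional variable `δ_{𝔙,(m,u_k)} := x_{𝔙',(m,u_k)}` (C38L7–L20) (Def. 5.15 C38L99–L109). Hence a standard chart of
`ℛ̃_{ϑ[k]}` over `𝔙_[0]` = a WORD `c : Fin Υ → ThetaKind` read up to position `k` (entries at no-change positions immaterial);
statements quantify over all words (`ThetaFrame.Chart`), levels `k ≤ Υ`. Indexing: Lean `j : Fin Υ` is the printed `k = j+1`.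

## Items ↦ declarations (FQ prefix `Literature.AlgebraicGeometry.Hu2025.Statements.S05ThetaBlowups.`)
* Def. 5.7 C35L112–L137; p.82 ↦ `Def5_7_termLT` (order on `S_F ∖ s_F`), `ThetaFrame.IndexBgov` + `Def5_7_govLT` (order on
  `𝓑^gov`), standing convention `C36L5` (the frame enumerates `S_{F_k} ∖ s_{F_k}` increasingly).
* C36L1–L2 («𝔱_{F_k} only assumes values 2 or 3») ↦ part of `ThetaFrame.IsStandard`; (eq-B-ktau) C36L13–L15 ↦ `ThetaFrame.gov0`;
  Index_{𝓑^gov} C36L23–L27 ↦ `ThetaFrame.IndexBgov`; «the order coincides with the lexicographic order» C36L29–L32 ↦ `C36L29`.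
* Def. 5.8 C36L34–L48; p.83 ↦ `Def5_8_plusTerm`, `Def5_8_minusTerm`; order on 𝔊 C36L50–L55 ↦ docstring of `Def5_7_govLT`.
* reminder C36L57–L67 (𝒱 ⊂ ℛ defined by B_(kτ), L_𝔉, 𝓑^ngv, 𝓑^𝔯𝔟 — Cor. 4.47) ↦ `ThetaFrame.eqns0` / `idealV0` (chart form =
  Prop. 4.56 display C32L147–C33L6, row 105's `Prop4_56`).
* Def. 5.9 C36L96–L147; p.84 ↦ `ThetaFrame.thetaCentreIdeal` (= `Def5_9`), `ThetaFrame.step`, `ThetaFrame.seq` (the blow-up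
  sequence seen from a chart); ϖ-, ϱ-, 𝔏-divisors upstairs C37L1–L11 ↦ docstring of `Prop5_11`.
* Prop. 5.10 C36L149–L175 [OPT per PARTITION-HU row 106] — not typed (torus actions index-only, PARTITION-HU §2); see `Prop5_12_weak`.
* Prop. 5.11 C37L23–C38L30; p.86 ↦ `ThetaFrame.eSet`, `ThetaFrame.dSet`, `ThetaFrame.epsVar`, `ThetaFrame.deltaVar`, the chart
  divisor ideals `ThetaFrame.plDivAt/rhoDivAt/LDivAt/excDivAt` and label map `ThetaFrame.labAt` (same SHAPE as row 108's Prop. 6.11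
  record at `𝔩_𝔙 = ∅` — Prop. 6.11's initial case is Prop. 5.11 with k = Υ, C48L64–L68), `Prop5_11_labels`, `Prop5_11`.
* convention (conv:=1) C38L32–L39 ↦ `C38L37_xP`, `C38L37_xR`.
* diagram C38L41–L54 (Ṽ_{ϑ[k]} = proper transform of 𝒱; «Alternatively … the proper transform of Ṽ_{ϑ[k−1]}») ↦
  `ThetaFrame.idealVTilde` (OURS carrier: iterated strict transform, `ChartSeq.strictTransform`).
* Prop. 5.12 C38L56–L62 ↦ `Prop5_12_weak` (WEAK reading, named as such: «quasi-free» not encoded; OPT-adjacent).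
* Def. 5.13 C38L64–L73; p.88 ↦ `ThetaFrame.govAt`, `ngvAt`, `rbAt`, `linAt` (= `Def5_13_B`, `Def5_13_L`).
* Def. 5.14 C38L77–L88; p.89 ↦ `ThetaFrame.BgovLT/BgovGT/BngvGT/LinLT/LinGT` (= `Def5_14`).
* C38L90–L97 (ℛ̃_{ϑ[k]} ⊂ ℛ̃_{ϑ[k−1]} × ℙ_{ϑ_k}, [ξ_0,ξ_1] ↔ (X_{u_k}, X_{(m,u_k)})) ↦ docstring of `ThetaKind`.
* Def. 5.15 C38L99–L109; p.89 ↦ `Def5_15_varpi`, `Def5_15_varrho`; (fV-fV0) C38L111–L122 ↦ `ThetaFrame.proj` (π_{𝔙,𝔙_[0]}).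
* Prop. 5.16 C38L124–C39L38 (proof C39L40–C40L85); p.89 ↦ displayed equations `Prop5_16_dispGov`, `Prop5_16_dispLin`
  (cases (A) C38L134–L145 / (B) C39L1–L12), `ThetaFrame.equationsAt`, `Prop5_16_1` (defining equations = JOINT J3 read),
  `Prop5_16_2` («Moreover»), `Prop5_16_3_weak` («Furthermore» without the «in the form of» clauses), `Prop5_16_3` (the whole
  «Furthermore» clause under the READING recorded in its docstring), `Prop5_16` (= _1 ∧ _2 ∧ _3), `Prop5_16_weak` (= _1 ∧ _2 ∧ _3_weak).
* «ϱ-linear», «square-free» (used by Prop. 5.16 / Cor. 5.17; defined in §4: Def. 4.3 ‹4.2› C21L113–L120, Def. 4.19 ‹4.18›) ↦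
  local chart-level readings `IsRhoLinearExp`, `Binomial.IsSquareFree` (dictionary: res-type-024 `IsRhoLinear`; row 104 `Def4_19`).
* C40L87–L89 (ℛ̃_ϑ := ℛ̃_{ϑ[Υ]}, Ṽ_ϑ) ↦ level `Φ.N`; Cor. 5.17 C40L91–L101; p.93 ↦ `Cor5_17`; Cor. 5.18 C40L103–L143; p.93 ↦
  `Cor5_18`, `Cor5_18_cover` (PARTIAL: chart-local form); Def. 5.19 C40L145–L147; p.94 ↦ `ThetaFrame.IsPreferred` (= `Def5_19`);
  Rem. 5.20 C41L1–L4; p.94 ↦ `Rem5_20_1`, `Rem5_20_2`.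

## Sic / reading notes (none takes a side)
* Prop. 5.10 C36L150–L151 and Prop. 5.12 C38L57–L58 print «on ℛ̃_{ϑ[k]} lifts to … on ℛ̃_{ϑ[k]}» / «on Ṽ_{ϑ[k]} lifts to … on
  Ṽ_{ϑ[k]}» [sic: evidently ϑ[k−1] → ϑ[k]].
* Prop. 5.16 C38L128 «(m,u_k) ∈ Λ^o_[k]» / Cor. 5.18 C40L120: the chart `𝔙_[0]` of `ℛ` is indexed by `Λ^o_𝔉` (Def. 4.45); read as
  «the F_k-component of the chart index is the leading term», i.e. `x_{(m,u_k)} ≡ 1` on `𝔙_[0]` (C39L65–L68) = `lead = none`.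
* Prop. 5.16 (A) display C38L140 writes `δ_{𝔙,(m,u_k)}` also in the sub-case `(m,u_k) ∈ Λ^o` where no δ exists (x ≡ 1): typed
  `xOpt (lead k)` (= 1 there) — recorded, the owner may split the display into the two sub-cases.
* (ngv-bi) C31L186–L189 (Def. 4.50 ‹chunk 4.49›) prints a stray factor `x_{u_t}` in the minus term; the chart form Prop. 4.56 C33L1–L3 (typed here) has none.
* Prop. 5.11 proof, no-change step (C37L110–L116): literally Def. 5.1 would give two charts `(ξ_0 ≡ 1) ⊊ (ξ_1 ≡ 1) = 𝔙'` over
  such `𝔙'`; the text's «𝔙 → 𝔙' is an isomorphism … Var_𝔙 = Var_𝔙'» is typed (one chart, identity step).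
* «Ṽ_{ϑ[k]} is the proper transform of 𝒱» (C38L49–L50) has no printed chart-level definition; typed through the strict
  transform (`ChartStep.strictTransform`, OURS VOCABULARY of `R106aCharts`), iterated step by step as in «Alternatively»
  C38L52–L54. The manuscript's equations for it are Prop. 5.16's LIST — their agreement is joint J3 (G-H2).
-/


noncomputable section

open MvPolynomial

namespace Literature.AlgebraicGeometry.Hu2025.Statements.S05ThetaBlowups

universe u v

/-! ## Extension of the interface: transforms along a word of steps -/

namespace ChartSeq

variable {R : Type u} [CommRing R] {V : Type v} [DecidableEq V]

/-- Iterated term-wise proper transform (Def. 5.4, `ChartStep.properTransform`) of a binomial along a word of steps, root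
chart first (Def. 5.13 C38L69–L73 «Suppose B_𝔙' … have been constructed over 𝔙'. Applying Definition (general-proper-transforms),
we obtain their proper transforms on the chart 𝔙»).
[claim: Hu2025, status: under-review]
STATUS: candidate statement under adjudication (D-0012/D-0089); not asserted. -/
def properTransform (w : ChartSeq V) (B : Binomial V) : Binomial V :=
  w.foldl (fun B s => s.properTransform B) B

variable (R) in
/-- Iterated strict transform of an ideal along a word of steps, root chart first (OURS VOCABULARY, see
`ChartStep.strictTransform`): the chart ideal of the proper transform of a closed subscheme taken step by step — C38L52–L54
«Alternatively, we can set Ṽ_{ϑ[0]} := 𝒱_𝔉. Suppose Ṽ_{ϑ[k−1]} has been constructed for some k ∈ [Υ]. We then let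
Ṽ_{ϑ[k]} ⊂ ℛ̃_{ϑ[k]} be the proper transform of Ṽ_{ϑ[k−1]}». Tree anchor (scheme level, one step):
`Literature.AlgebraicGeometry.Resolution.MarkedIdeals.strictTransformIdeal` [cite: GortzWedhorn2020, (13.19)]; labelled OURS as in
`ChartStep.strictTransform` — [Hu25] uses «proper transform» of subschemes as a known notion without a chart-level definition.
[claim: Hu2025, status: under-review]
STATUS: candidate statement under adjudication (D-0012/D-0089); not asserted — OURS carrier. -/
def strictTransform (w : ChartSeq V) (I : Ideal (MvPolynomial V R)) : Ideal (MvPolynomial V R) :=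
  w.foldl (fun I s => s.strictTransform (R := R) I) I

end ChartSeq

namespace Binomial

variable {V : Type v}

/-- «square-free» for a binomial on a chart (Prop. 5.16 C39L19–L20, C39L38; Cor. 5.17 C40L101; the §4 notion is Def. 4.19
‹chunk 4.18› C24L100 ff., row 104 `Def4_19`): chart-level reading used here — every variable occurs in each term with exponent
≤ 1. (Dictionary/faithfulness to Def. 4.19 is the row-104/106 owners' call.)
[claim: Hu2025, status: under-review]
STATUS: candidate statement under adjudication (D-0012/D-0089); not asserted. -/
def IsSquareFree (B : Binomial V) : Prop := (∀ x, B.plus x ≤ 1) ∧ ∀ x, B.minus x ≤ 1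

end Binomial

/-! ## The kinds of a ϑ-step on a chart (Def. 5.15) -/

/-- The two standard charts of one ϑ-blow-up over a chart `𝔙'` (C38L90–L97 «ℛ̃_{ϑ[k]} ⊂ ℛ̃_{ϑ[k−1]} × ℙ_{ϑ_k} … [ξ_0, ξ_1]
corresponds to (X_{u_k}, X_{(m,u_k)})»; Def. 5.15 C38L99–L109): `varpi` = the ϖ-standard chart `ℛ̃_{ϑ[k]} ∩ (𝔙' × (ξ_0 ≡ 1))`
(exceptional variable `ε_{𝔙,u_k} = x_{𝔙',u_k}`, C37L147–L150), `varrho` = the ϱ-standard chart `ℛ̃_{ϑ[k]} ∩ (𝔙' × (ξ_1 ≡ 1))`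
(exceptional variable `δ_{𝔙,(m,u_k)} = x_{𝔙',(m,u_k)}`, C38L17–L20).
[claim: Hu2025, status: under-review]
STATUS: candidate statement under adjudication (D-0012/D-0089); not asserted. -/
inductive ThetaKind : Type
  | varpi
  | varrho

/-- Case distinction on the chart kind without pattern matching (statement-lane hygiene): `κ.by a b` is `a` on the ϖ-standard
chart and `b` on the ϱ-standard chart (the two charts of Def. 5.15, C38L99–L109; p.89). Plumbing.
[claim: Hu2025, status: under-review]
STATUS: candidate statement under adjudication (D-0012/D-0089); not asserted. -/
def ThetaKind.by {α : Sort*} (κ : ThetaKind) (a b : α) : α := ThetaKind.rec (motive := fun _ => α) a b κ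

/-! ## The frame: the §3–§4 data read by §5.2–§5.4 on a chart `𝔙_[0]` of `ℛ` -/

/-- **The §3–§4 data consumed by §5.2–§5.4 on one chart `𝔙_[0]` of `ℛ = ℛ̃_{ϑ[0]}` (OURS packaging; dictionary in the module
docstring «The FRAME»).** `N` = Υ (C20L44–L48); `t k` = 𝔱_{F_k} (C36L1 «(𝔱_{F_k}+1) be the number of terms in F_k»); `ult k` =
`u_k = u_{F_k}` (C36L120); `lead k` = the leading ϱ-coordinate `x_{((123),u_{F_k})}` (Def. 4.48 ‹chunk 4.47› C31L162–L163) as a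
variable of `𝔙_[0]` — `none` when it is the chart's `≡ 1` coordinate, «(m,u_k) ∈ Λ^o» (C38L128, C39L65–L68); `termR k τ`,
`termP₁ k τ`, `termP₂ k τ` = the ϱ-coordinate `x_{(u_{s_τ},v_{s_τ})}` (variable or `≡ 1`) and the ϖ-indices `u_{s_τ}, v_{s_τ}` of the
`τ`-th non-leading term `s_τ ∈ S_{F_k} ∖ s_{F_k}` (C36L3–L5, C36L13–L15); `sgnLead k`, `sgnTerm k τ` = `sgn(s_F)`, `sgn(s)`
(C32L162, C38L140); `blk` = the block `F` of a ϱ-index (Def. 4.3 ‹4.2› C21L113–L114 «homogenous in [x_{(u_s,v_s)}]_{s ∈ S_{F_i}},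
for every i»); `rb` = the 𝔯𝔟-binomials `𝓑^𝔯𝔟` in their chart form on `𝔙_[0]` (Prop. 4.56 C32L149–L154; row 104).
[claim: Hu2025, status: under-review]
STATUS: candidate statement under adjudication (D-0012/D-0089); not asserted — OURS packaging of printed data. -/
structure ThetaFrame (P : Type v) (Rs : Type v) where
  /-- `Υ`, the number of primary Plücker relations = of ϑ-sets (C20L44–L48, C36L112–L124) -/
  N : ℕ
  /-- `𝔱_{F_k}` = number of non-leading terms of `F_k` (C36L1–L2: «only assumes values 2 or 3») -/
  t : Fin N → ℕ
  /-- `u_k = u_{F_k} ∈ 𝕀^lt ⊂ 𝕀^⋆`, the leading ϖ-index of `F_k` (C36L120; Def. 3.4) -/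
  ult : Fin N → P
  /-- the leading ϱ-coordinate `(m,u_k)` as a variable of `𝔙_[0]`; `none` ⟺ `(m,u_k) ∈ Λ^o` (≡ 1 on the chart) -/
  lead : Fin N → Option Rs
  /-- ϱ-coordinate `(u_{s_τ}, v_{s_τ})` of the `τ`-th non-leading term of `F_k`; `none` ⟺ it is the chart's `≡ 1` coordinate -/
  termR : (k : Fin N) → Fin (t k) → Option Rs
  /-- `u_{s_τ}` (C21L18 «F̄ = Σ_{s ∈ S_F} sgn(s) x_{u_s} x_{v_s}») -/
  termP₁ : (k : Fin N) → Fin (t k) → P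
  /-- `v_{s_τ}` -/
  termP₂ : (k : Fin N) → Fin (t k) → P
  /-- `sgn(s_{F_k})`, the sign of the leading term in `L_{F_k}` (C38L140 «sgn(s_F) δ_{𝔙,(m,u_k)}») -/
  sgnLead : Fin N → ℤ
  /-- `sgn(s_τ)` (C38L141 «Σ_{s ∈ S_F ∖ s_F} sgn(s) x_{𝔙,(u_s,v_s)}») -/
  sgnTerm : (k : Fin N) → Fin (t k) → ℤ
  /-- the block `F` of a ϱ-variable of `𝔙_[0]` (for «ϱ-linear», Def. 4.3 ‹4.2›) -/
  blk : Rs → Fin N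
  /-- `𝓑^𝔯𝔟` restricted to `𝔙_[0]` (Prop. 4.56; row 104 `Def4_32`), as binomials in the chart variables -/
  rb : Set (Binomial (P ⊕ Rs))

namespace ThetaFrame

variable {P : Type v} {Rs : Type v} [DecidableEq P] [DecidableEq Rs]
variable (Φ : ThetaFrame P Rs)

/-- A standard chart of `ℛ̃_{ϑ[k]}` lying over `𝔙_[0]` is recorded by the word of its chart choices at the ϑ-steps (module
docstring «Standard charts»; Def. 5.9 C36L126–L140, Def. 5.15 C38L99–L109); positions `≥ k` and no-change positions
(`lead = none`) are immaterial.
[claim: Hu2025, status: under-review]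
STATUS: candidate statement under adjudication (D-0012/D-0089); not asserted — OURS bookkeeping. -/
abbrev Chart (Φ : ThetaFrame P Rs) : Type := Fin Φ.N → ThetaKind

/-- **Standing facts about the frame printed in §§3–5 (typed as ONE hypothesis the owner may split):** (i) `u_1 < ⋯ < u_Υ` are
distinct (C36L120); (ii) `𝔱_{F_k} ∈ {2, 3}` (C36L2); (iii) on the chart `𝔙_[0]` exactly one coordinate of each block `F_k` is
`≡ 1` (Def. 4.45 ‹chunk 4.44› C30L81–L91 «choose and fix an arbitrary element s_{F_i,o} ∈ S_{F_i} … (x_{(u_{s_{F_i,o}},v_{s_{F_i,o}})} ≡ 1)»):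
either the leading one (`lead k = none`) or exactly one non-leading one; (iv) the ϱ-variables of block `F_k` have `blk = k` and
distinct terms have distinct ϱ-coordinates ((4.1) C21L24–L30); (v) the signs are units `sgn(s) ∈ {±1}` (C18L34–L41 «F = Σ_{s ∈ S_F}
sgn(s) p_{u_s} p_{v_s}», coefficients `±1` by the explicit forms C18L16–L27) — v3 (res-type-023 g8): needed by Prop. 5.11 bullet (3).
[claim: Hu2025, status: under-review]
STATUS: candidate statement under adjudication (D-0012/D-0089); not asserted. -/
def IsStandard : Prop :=
  Function.Injective Φ.ult ∧
  (∀ k, Φ.t k = 2 ∨ Φ.t k = 3) ∧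
  (∀ k, (Φ.lead k = none ∧ ∀ τ, Φ.termR k τ ≠ none) ∨
        (Φ.lead k ≠ none ∧ ∃ τ₀, Φ.termR k τ₀ = none ∧ ∀ τ, τ ≠ τ₀ → Φ.termR k τ ≠ none)) ∧
  (∀ k r, Φ.lead k = some r → Φ.blk r = k) ∧
  (∀ k τ r, Φ.termR k τ = some r → Φ.blk r = k ∧ Φ.lead k ≠ some r) ∧
  (∀ k τ τ' r, Φ.termR k τ = some r → Φ.termR k τ' = some r → τ = τ') ∧
  (∀ k, Φ.sgnLead k = 1 ∨ Φ.sgnLead k = -1) ∧ (∀ k τ, Φ.sgnTerm k τ = 1 ∨ Φ.sgnTerm k τ = -1)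

/-! ### Def. 5.7, (eq-B-ktau), Def. 5.8 — orders and the governing binomials indexed by `(k τ)` -/

/-- **Definition 5.7, first part (C35L112–L124; p.82): the total order on `S_F ∖ s_F`.** «Suppose rk F = 0. Then, S_F ∖ s_F
consists of two elements {s, t}. We say s < t if (u_s, v_s) <_lex (u_t, v_t) where each pair is listed lexicographically
according to the order on the set of all ℘ variables. • Suppose rk F = 1. Then, for any s ∈ S_F ∖ s_F, one of p_{u_s} and
p_{v_s} is a basic variable, the other is of rank equal to 0. Without loss of generality, we suppose rk p_{u_s} = 0 … we say
s < t if u_s < u_t, that is, F_{u_s} < F_{u_t}.» Typed as a relation on the ϖ-index pairs of two terms, given the order on the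
℘-variables (Def. 3.14, row 102) as `[LinearOrder P]`, the rank `rkF` of `F` (Def. 3.1) and the predicate «`p_u` is of rank 0»
(`u ∈ 𝕀^{lt,0}`, (Ilt0) C20L60–L65; row 101/102) as `isRankZeroVar`.
[claim: Hu2025, status: under-review]
STATUS: candidate statement under adjudication (D-0012/D-0089); not asserted. -/
def _root_.Literature.AlgebraicGeometry.Hu2025.Statements.S05ThetaBlowups.Def5_7_termLT [LinearOrder P]
    (rkF : ℕ) (isRankZeroVar : P → Bool) (a b : P × P) : Prop :=
  if rkF = 0 then
    -- «each pair is listed lexicographically»: compare the sorted pairs in the lexicographic order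
    toLex (min a.1 a.2, max a.1 a.2) < toLex (min b.1 b.2, max b.1 b.2)
  else
    -- rank 1: compare the members of rank 0 («WLOG rk p_{u_s} = 0»)
    (if isRankZeroVar a.1 then a.1 else a.2) < (if isRankZeroVar b.1 then b.1 else b.2)

/-- **Standing convention C36L3–L5 (p.83): «we can list S_{F_k} as S_{F_k} = {s_{F_k}; s_1 < ⋯ < s_{𝔱_{F_k}}}»** — the frame
enumerates the non-leading terms of every `F_k` INCREASINGLY for Def. 5.7's order (the rank of `F_k` is `𝔱_{F_k} − 2`,
Def. 3.1 C16L137–L139). Typed as the Prop the owner instantiates/assumes.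
[claim: Hu2025, status: under-review]
STATUS: candidate statement under adjudication (D-0012/D-0089); not asserted. -/
def C36L5 [LinearOrder P] (isRankZeroVar : P → Bool) : Prop :=
  ∀ (k : Fin Φ.N) (τ τ' : Fin (Φ.t k)), τ < τ' ↔
    Def5_7_termLT (Φ.t k - 2) isRankZeroVar (Φ.termP₁ k τ, Φ.termP₂ k τ) (Φ.termP₁ k τ', Φ.termP₂ k τ')

/-- **`Index_{𝓑^gov}` ((eq-B-ktau)/(Index) C36L7–L27; p.83).** «𝓑^gov_{F_k} = {B_(kτ) ∣ τ ∈ [𝔱_{F_k}]} … 𝓑^gov = ⊔_{k ∈ [Υ]}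
𝓑^gov_{F_k} = {B_(kτ) ∣ k ∈ [Υ], τ ∈ [𝔱_{F_k}]}, we let Index_{𝓑^gov} = {(kτ) ∣ k ∈ [Υ], τ ∈ [𝔱_{F_k}]} ⊂ ℤ × ℤ be the index
set of 𝓑^gov.»
[claim: Hu2025, status: under-review]
STATUS: candidate statement under adjudication (D-0012/D-0089); not asserted. -/
abbrev IndexBgov (Φ : ThetaFrame P Rs) : Type := Σ k : Fin Φ.N, Fin (Φ.t k)

/-- **Definition 5.7, second part (C35L126–L134; p.82) with C36L29–L32 and the order on 𝔊 (C36L50–L55; Def. 4.52 ‹4.51›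
C32L37–L39).** «For any B' ∈ 𝓑^gov_{F'} and B ∈ 𝓑^gov_F with F' ≠ F, we say B' < B if F' < F. … for any two distinct
s, t ∈ S_F ∖ s_F, we say B_{F,(s_F,s)} < B_{F,(s_F,t)} if s < t»; C36L29–L32 «the order "<" on the set 𝓑^gov coincides with the
lexicographic order on Index_{𝓑^gov}, that is, B_(kτ) < B_(k'τ') ⟺ (k,τ) <_lex (k',τ')»; C36L53–L54 «We say 𝔊_{F'} < 𝔊_F if
F' < F». Typed: the lexicographic order on `Index_{𝓑^gov}` (definitional given `C36L5`).
[claim: Hu2025, status: under-review]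
STATUS: candidate statement under adjudication (D-0012/D-0089); not asserted. -/
def _root_.Literature.AlgebraicGeometry.Hu2025.Statements.S05ThetaBlowups.Def5_7_govLT
    {Φ : ThetaFrame P Rs} (a b : Φ.IndexBgov) : Prop :=
  a.1 < b.1 ∨ (a.1 = b.1 ∧ (a.2 : ℕ) < (b.2 : ℕ))

/-- **C36L29–L32 (p.83), the claim itself: «the order "<" on the set 𝓑^gov coincides with the lexicographic order on
Index_{𝓑^gov}»** — with `𝓑^gov` indexed by `Index_{𝓑^gov}` and ordered by Def. 5.7 this is the definition of `Def5_7_govLT`;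
recorded as the (definitionally true) Prop for the INDEX.
[claim: Hu2025, status: under-review]
STATUS: candidate statement under adjudication (D-0012/D-0089); not asserted. -/
def C36L29 : Prop := ∀ a b : Φ.IndexBgov, Def5_7_govLT a b ↔ (a.1 < b.1 ∨ (a.1 = b.1 ∧ (a.2 : ℕ) < (b.2 : ℕ)))

/-- Exponent vector of an optional ϱ-coordinate of `𝔙_[0]`: the variable `x_{(u,v)}` if it is one, nothing (the coordinate is
`≡ 1`) otherwise (Def. 4.45 / Prop. 4.54 proof C32L116–L123 «Upon setting x_{(u_{s_{F_i,o}},v_{s_{F_i,o}})} ≡ 1 …»). Plumbing.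
[claim: Hu2025, status: under-review]
STATUS: candidate statement under adjudication (D-0012/D-0089); not asserted. -/
def eOpt (o : Option Rs) : (P ⊕ Rs) →₀ ℕ := o.elim 0 fun r => Finsupp.single (Sum.inr r) 1

/-- Exponent vector of the ϖ-variable `x_w`, `w ∈ 𝕀^⋆` (Def. 4.1 C21L34–L35 «a ℘ variable, x_u with u ∈ 𝕀_{3,n} ∖ m, a
ϖ-variable»). Plumbing.
[claim: Hu2025, status: under-review]
STATUS: candidate statement under adjudication (D-0012/D-0089); not asserted. -/
def eP (w : P) : (P ⊕ Rs) →₀ ℕ := Finsupp.single (Sum.inl w) 1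

/-- **The governing binomial `B_(kτ) = B_{F_k,(s_{F_k},s_τ)}` in its chart form on `𝔙_[0]` ((eq-B-ktau) C36L13–L15 «B_(kτ):
x_{(u_{s_τ},v_{s_τ})} x_{u_{F_k}} − x_{(m,u_{F_k})} x_{u_{s_τ}} x_{v_{s_τ}}, ∀ s_τ ∈ S_{F_k} ∖ s_{F_k}»; Def. 4.50 ‹chunk 4.49›
(gov-bi) C31L176–L181; chart form Prop. 4.56 C32L158–L160 «B_{𝔙,(s_F,s)}: x_{𝔙,(u_s,v_s)} x_{𝔙,u_F} − x_{𝔙,(m,u_F)}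
x_{𝔙,u_s} x_{𝔙,v_s}», with the chart's `≡ 1` coordinate omitted).** As a `Binomial`: plus term `x_{(u_s,v_s)} x_{u_F}`, minus term
`x_{(m,u_F)} x_{u_s} x_{v_s}` (Def. 5.8).
[claim: Hu2025, status: under-review]
STATUS: candidate statement under adjudication (D-0012/D-0089); not asserted. -/
def gov0 (k : Fin Φ.N) (τ : Fin (Φ.t k)) : Binomial (P ⊕ Rs) where
  plus := eOpt (Φ.termR k τ) + eP (Φ.ult k)
  minus := eOpt (Φ.lead k) + eP (Φ.termP₁ k τ) + eP (Φ.termP₂ k τ)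

/-- **Definition 5.8, the plus-term `T⁺_(kτ) = x_{(u_{s_τ},v_{s_τ})} x_{u_{F_k}}` (C36L34–L39; p.83)** (chart form on `𝔙_[0]`).
C36L47–L48: «We do not name any term of a binomial of 𝓑^ngv ∪ 𝓑^𝔯𝔟 a plus-term or a minus-term».
[claim: Hu2025, status: under-review]
STATUS: candidate statement under adjudication (D-0012/D-0089); not asserted. -/
def _root_.Literature.AlgebraicGeometry.Hu2025.Statements.S05ThetaBlowups.Def5_8_plusTerm
    (Φ : ThetaFrame P Rs) (k : Fin Φ.N) (τ : Fin (Φ.t k)) : (P ⊕ Rs) →₀ ℕ := (Φ.gov0 k τ).plus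

/-- **Definition 5.8, the minus-term `T⁻_(kτ) = x_{(m,u_{F_k})} x_{u_{s_τ}} x_{v_{s_τ}}` (C36L40–L45; p.83)** (chart form on
`𝔙_[0]`; «B_(kτ) = T⁺_(kτ) − T⁻_(kτ)»).
[claim: Hu2025, status: under-review]
STATUS: candidate statement under adjudication (D-0012/D-0089); not asserted. -/
def _root_.Literature.AlgebraicGeometry.Hu2025.Statements.S05ThetaBlowups.Def5_8_minusTerm
    (Φ : ThetaFrame P Rs) (k : Fin Φ.N) (τ : Fin (Φ.t k)) : (P ⊕ Rs) →₀ ℕ := (Φ.gov0 k τ).minus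

/-- **The non-governing binomial `B_{F_k,(s,t)}` in its chart form on `𝔙_[0]` (Prop. 4.56 display C33L1–L3 «B_{𝔙,(s,t)}:
x_{𝔙,(u_s,v_s)} x_{𝔙,u_t} x_{𝔙,v_t} − x_{𝔙,(u_t,v_t)} x_{𝔙,u_s} x_{𝔙,v_s}, ∀ s, t ∈ S_F ∖ s_F»; Def. 4.50 ‹chunk 4.49› (ngv-bi)
C31L184–L189, which prints an extra factor `x_{u_t}` in the minus term [sic]).**
[claim: Hu2025, status: under-review]
STATUS: candidate statement under adjudication (D-0012/D-0089); not asserted. -/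
def ngv0 (k : Fin Φ.N) (τ τ' : Fin (Φ.t k)) : Binomial (P ⊕ Rs) where
  plus := eOpt (Φ.termR k τ) + eP (Φ.termP₁ k τ') + eP (Φ.termP₂ k τ')
  minus := eOpt (Φ.termR k τ') + eP (Φ.termP₁ k τ) + eP (Φ.termP₂ k τ)

section WithRing

variable (R : Type u) [CommRing R]

/-- The chart value of an optional ϱ-coordinate: the variable, or `1` when the coordinate is the chart's `≡ 1` one
(Prop. 4.54 proof C32L121–L123; C39L65–L72 «x_{𝔙_[0],(m,u_k)} ≡ 1, hence x_{𝔙,(m,u_k)} ≡ 1»). Plumbing.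
[claim: Hu2025, status: under-review]
STATUS: candidate statement under adjudication (D-0012/D-0089); not asserted. -/
def xOpt (o : Option Rs) : MvPolynomial (P ⊕ Rs) R := o.elim 1 fun r => X (Sum.inr r)

/-- **The de-homogenised linearized Plücker relation `L_{𝔙_[0],F_k}` on the chart `𝔙_[0]` (Prop. 4.56 display C32L162
«L_{𝔙,F}: Σ_{s ∈ S_F} sgn(s) x_{𝔙,(u_s,v_s)}»; Prop. 4.54 C32L101 «the de-homogenized linearized ℘ relations L_{𝔙,F}»; Def. 4.37
‹4.36› for L_F).** The chart's `≡ 1` coordinate contributes its sign as a constant.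
[claim: Hu2025, status: under-review]
STATUS: candidate statement under adjudication (D-0012/D-0089); not asserted. -/
def lin0 (k : Fin Φ.N) : MvPolynomial (P ⊕ Rs) R :=
  Φ.sgnLead k • xOpt R (Φ.lead k) + ∑ τ : Fin (Φ.t k), Φ.sgnTerm k τ • xOpt R (Φ.termR k τ)

/-- The governing binomials on `𝔙_[0]` as a set (C36L19 «𝓑^gov = ⊔_{k ∈ [Υ]} 𝓑^gov_{F_k}»).
[claim: Hu2025, status: under-review]
STATUS: candidate statement under adjudication (D-0012/D-0089); not asserted. -/
def Bgov0 : Set (Binomial (P ⊕ Rs)) := Set.range fun i : Φ.IndexBgov => Φ.gov0 i.1 i.2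

/-- The non-governing binomials (of ϱ-degree 1) on `𝔙_[0]` as a set (Prop. 4.56 C33L1–L6, all `F ∈ 𝔉`, `s ≠ t`).
[claim: Hu2025, status: under-review]
STATUS: candidate statement under adjudication (D-0012/D-0089); not asserted. -/
def Bngv0 : Set (Binomial (P ⊕ Rs)) := {B | ∃ (k : Fin Φ.N) (τ τ' : Fin (Φ.t k)), τ ≠ τ' ∧ B = Φ.ngv0 k τ τ'}

/-- **The defining relations of `𝒱 ∩ 𝔙_[0]` in the chart `𝔙_[0]` of `ℛ` as the manuscript LISTS them (reminder C36L57–L67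
«by Corollary (eq-tA-for-sV), the scheme 𝒱, as a closed subscheme of ℛ = 𝕌 × Π_{F ∈ 𝔉} ℙ_F, is defined by the following
relations B_(kτ), L_𝔉, 𝓑^ngv, 𝓑^𝔯𝔟»; chart form Prop. 4.56 C32L147–L154 «the scheme 𝒱 ∩ 𝔙, as a closed subscheme of the
chart 𝔙 of ℛ, is defined by 𝓑_𝔙 ⊔ {L_{𝔙,F_i}, i ∈ [Υ]} where 𝓑 = 𝓑^gov ⊔ 𝓑^ngv ⊔ 𝓑^𝔯𝔟» — row 105's `Prop4_56`; here it is
the STARTING LIST of §5, not a claim).**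
[claim: Hu2025, status: under-review]
STATUS: candidate statement under adjudication (D-0012/D-0089); not asserted. -/
def eqns0 : Set (MvPolynomial (P ⊕ Rs) R) :=
  (Binomial.toPoly (R := R) '' (Φ.Bgov0 ∪ Φ.Bngv0 ∪ Φ.rb)) ∪ Set.range (Φ.lin0 R)

/-- The ideal of `𝒱 ∩ 𝔙_[0] = Ṽ_{ϑ[0]} ∩ 𝔙_[0]` generated by the listed relations (`eqns0`; C38L52 «we can set
Ṽ_{ϑ[0]} := 𝒱_𝔉»). (The honest ideal of the closure `𝒱` of the graph of `Θ` on the chart is row 103's `modelVIdeal`; that the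
two agree is row 105's `Prop4_56` — not used here.)
[claim: Hu2025, status: under-review]
STATUS: candidate statement under adjudication (D-0012/D-0089); not asserted. -/
def idealV0 : Ideal (MvPolynomial (P ⊕ Rs) R) := Ideal.span (Φ.eqns0 R)

end WithRing

end ThetaFrame

end Literature.AlgebraicGeometry.Hu2025.Statements.S05ThetaBlowups

end
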